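import Summits.QuantumFields.YangMills.Theorems.BalabanUVNodesN11NodeFaceOfSplitBgSupplierBorel
import Summits.QuantumFields.YangMills.Theorems.BalabanUVNodesN11BgProvisoFamilyBelowFloorAtRecord

/-!
# DAG node N11 — THE NODE `Dag.B14_main (leavesP w P)` ON EVERY WINDOW RUN OF A K1-KEYED WORLD ON THE SupplierBorel ROAD, ITS bg FACTS SUPPLIED BY THE ONE-BLOCK TAIL'S TWO ANALYTIC
# SUPPLIERS: dag-n11-w1 g4's `…N11NodeFaceOfSplitBgSupplierBorel` with the per-level one-block producer `hob` REPLACED by (C) global regularity of the all-small histories and (D) the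
# large-field space at switch levels (this seat's `…BgProvisoFamilyBelowFloorAtRecord` §3) — dag-n11-w1 g4 HANDOFF (n2), first refusal n11-w4, taken

HEADER — WORK-UNIT METADATA.  Cell `pub-ymgap`, YM-PLAN Track A (HUMAN RULING D-0062 ∕ D-0149 width seats), seat `pub-ymgap-dag-n11-w4` (g5; WIDTH SEAT 4 of 4 on NODE n11
[B14]), route `BalabanUVNodes` rev 29, deciding item K1⁹ `StabilityBRunRowsAtRecordR13SepCoPHV` = stmt-QuantumFields-27364 (helper lane, `--kind proof --supports 27364 --as helper`,
count-neutral).  [III] = [Balaban1988Convergent], [15] = [Balaban1985Variational], [I] = [Balaban1987RG1].  Over dag-n11-w1 g4's p638594 `…N11NodeFaceOfSplitBgSupplierBorel` (§1 socket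
`b14_main_leavesP_of_supplyChainAt_of_window_of_flowIneq26`: N11's node from a chain asked only on window runs obeying (2.6); H3 token `supplyChainAt_of_gaussCert_of_supplierBorel_of_bgFacts_of_powM`
via its import) and this seat's `…N11BgProvisoFamilyBelowFloorAtRecord` (§3 `bgProvisoΛ_family_atRecord_of_provisos₁₃SepCoPH_of_flowIneq26`: at a `Provisos₁₃SepCoPH` θ the whole bg-facts family of a
windowed (2.6)-run from (C), (D) alone).

WHY THIS FILE.  dag-n11-w1 g4's HANDOFF (n2) (first refusal to this seat): «Composition = FILE 6 §1 socket ∘ H3 token ∘ n11-w4's family: N11's node on EVERY window run from K0's guarded row +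
TRANSPORT + all-small regularity (C) + switch-level large-field space (D) — a strict refinement of FILE 6 (`hob` ↦ (B)(C)(D))».  With (B) now a theorem at the record (`transportB_atRecord`) and
the guarded row read off the key's `bg`, the refinement is `hob ↦ (C)(D)`: the per-LEVEL one-block producer (a `BgProvisoΛ` token at every level whose 𝐃-cube exceeds the torus, for every
history shape) becomes two per-HISTORY-SHAPE suppliers — `spaceI` on every domain at the all-small levels of the tail families, `spaceMS` at their switch levels; dead levels ask nothing.
Everything else — the socket, the Gaussian certificate rows `hζ ∕ hq`, the key, admissibility and signs, `0 < M₁ ≤ M`, `2 ≤ cR`, `L·M₂ ∣ M`, `M = L^a`, `r = 1`, the five numeric rows, K0's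
per-cube [15]-solvability, [III] §3's supplier with `SupplierObligations ∧ SupplierBorel`, the world letters `w.γ ≤ θ.γ`, `0 ≤ w.βup`, `w.βup·w.γ² ≤ 1` — is dag-n11-w1's, VERBATIM.

WHAT THIS FILE PROVES (0 `sorry`, 0 `def`; standard axioms; kernel composition BY NAME).  §1 per run: ★★★ `b14_main_leavesP_of_gaussCert_of_supplierBorel_of_tailSuppliers_of_powM`.  §2 every run
of the world (rows keyed on the window `]0, θ.γ]`): ★★★ `b14_main_leavesP_all_of_gaussCert_of_supplierBorel_of_tailSuppliers_of_powM`.  §3 at the NAMED certificate `gaussPinH θ` (no class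
hypothesis): ★★ `b14_main_leavesP_all_gaussPinH_of_supplierBorel_of_tailSuppliers_of_powM`.  §4 the PRINTED face at the K1-keyed datum (dag-n11-w1's `…Sect3SupplyChainBorelBThm1PrintedOfBgFacts`
with `hbgs` ↦ (2.6) along the `γ`-windowed runs — a DISPLAYED letter on this road — + the tail suppliers): ★★★ `thm1Printed_datumOfRecord₁₃SepCoPH_of_gaussCert_of_supplierBorel_of_tailSuppliers_of_powM` ·
★★★ `thm1Printed_datumOfRecord₁₃SepCoPH_gaussPinH_of_supplierBorel_of_tailSuppliers_of_powM`.

HONEST FRAMING.  Helper lane of K1⁹; count-neutral; every analytic row is DISPLAYED — (C), (D) ([III] (2.28) ∕ [15] Thm 1 content), the key's row `bg`, the supplier's obligations, K0's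
solvability, the certificate rows, and on the printed road (§4) [III] (2.6) along the windowed runs — and asserted by nobody; nothing of Bałaban asserted; NOT a discharge.  N11 NOT discharged; K1⁹ NOT closed, no registered stub of v9∕v10 touched; counts
unmoved (typed 28∕28 · discharged 5∕27 · A 5∕28).  One finite `𝕋⁴_{L^K}` programme at fixed `ε = L^{−K}`; R4 closes only the conditional finite-𝕋⁴ rung `BalabanLadder.UV` — NOT ℝ⁴, NOT OS,
NOT a mass gap, NOT Clay.  No `sorry`, `axiom`, `def`, `instance`, `notation`.  Sources (SHAPE ∕ bookkeeping only): [III] Thm 1 p.262, Theorem p.245, p.244 L36–38, §3 p.279, (2.5)–(2.6)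
p.255, p.257, (2.28) p.259, (3.24)–(3.25) p.270; [I] Thm 1 p.259, (0.20) p.256; [15] Thm 1 (7)–(8) pp.278–279.
-/

noncomputable section

open MeasureTheory
open scoped BigOperators ENNReal NNReal Matrix.Norms.L2Operator

namespace Summit.QuantumFields.YangMills.Theorems.BalabanUVNodesN11NodeFaceOfTailSuppliers

open Literature.MathematicalPhysics.QuantumFieldTheory.Balaban1983to89 T4Continuum T4NestedCovariance Node00 Node00.Tk DagBinding
open B15DeterminingSets B8Eq17ClassAkV1 B14.Eq218Concrete B10Eq42TorusConstraint Step
open B14.Eq213MaximalDomains (side)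
open B14.Eq213DetSet (Bj)
open Literature.MathematicalPhysics.QuantumFieldTheory.BalabanImbrieJaffe1984to88.BIJ85Eq453GaugeField (qsstarGIter0)
open BalabanUVNodesN11HistoryPinnedResidualDefs BalabanUVNodesN11RePinnedParamDefs
open BalabanUVNodesN11GaussianCertificateDefs (gaussPinH gaussPinH_ζ0 gaussPinH_quad)
open BalabanUVNodesN11Sect3SupplyChainDefs
open BalabanUVNodesN11Sect3SupplyChainBorelB
open BalabanUVNodesN11Sect3SupplyChainObligationsDefs
open BalabanUVNodesN11Sect3SupplyChainBorelBThm1PrintedOfSolvable (provisos₁₃SepCoPH_gaussPinH)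
open BalabanUVNodesN11Sect3SupplyChainBorelBOfBgFacts (supplyChainAt_of_gaussCert_of_supplierBorel_of_bgFacts_of_powM)
open BalabanUVNodesN11Sect3SupplyChainBorelBThm1PrintedOfBgFacts (thm1Printed_datumOfRecord₁₃CoPH_of_gaussCert_of_supplierBorel_of_bgFacts_of_powM)
open BalabanUVNodesN11NodeFaceOfSplitBgSupplierBorel (b14_main_leavesP_of_supplyChainAt_of_window_of_flowIneq26)
open BalabanUVNodesN11BgProvisoFamilyBelowFloorAtRecord (bgProvisoΛ_family_atRecord_of_provisos₁₃SepCoPH_of_flowIneq26)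

variable {F : T4Family} {N : ℕ} [NeZero N]

/-! ## §1  Per run: N11's node on the SupplierBorel road, the bg facts from the one-block tail's two suppliers -/

section PerRun

variable (θ : Stage13HParams F N) (p : B12.RunParams)

/-- **★★★ N11's DAG NODE `Dag.B14_main (leavesP w p)` ON THE SupplierBorel ROAD FOR A WINDOW RUN — bg FACTS FROM THE ONE-BLOCK TAIL'S TWO ANALYTIC SUPPLIERS** (world bound to the
K1-keyed SepCoPH datum of a Gaussian-class `θ` on the live-selector line, `w.γ ≤ θ.γ`, `0 ≤ w.βup`, `w.βup·w.γ² ≤ 1`; `M = L^a`, `r = 1`): dag-n11-w1's §1 socket (window + (2.6) handed to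
the chain) with the chain DISCHARGED by its H3 token, whose bg-fact binder `∀ k ≤ K, BgProvisoΛ …` is served by `bgProvisoΛ_family_atRecord_of_provisos₁₃SepCoPH_of_flowIneq26` from the
run's own window + (2.6): above the last compatible level `n₀` the key's row `bg`, below it the transport theorem and the two suppliers `hCD` — (C) `spaceI` on every domain at the all-small
levels of the tail families, (D) `spaceMS` at their switch levels (handed `n₀`, `PartCompat₁₃ θ p n₀` and the one-block tail).  All other rows VERBATIM from dag-n11-w1's
`b14_main_leavesP_of_gaussCert_of_supplierBorel_of_oneBlockSupply_of_powM`. [cite: Balaban1988Convergent, Thm 1 p.262, Theorem p.245, p.244 L36–38, §3 p.279, (2.5)–(2.6) p.255, p.257, (2.28) p.259,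
(3.24)–(3.25) p.270; Balaban1987RG1, Thm 1 p.259, (0.20) p.256; Balaban1985Variational, Thm 1 (7)–(8) pp.278–279] -/
theorem b14_main_leavesP_of_gaussCert_of_supplierBorel_of_tailSuppliers_of_powM
    (hζ : ∀ (p' : B12.RunParams) (n : ℕ) (Ω Λ : ℕ → Set (Site (F.P p'.K) 0)), (θ.Zh p' n Ω Λ).ζ0 = (ZhPinOfRecord₁₃ θ.toStage13Params p' Ω Λ).ζ0)
    (hq : ∀ (p' : B12.RunParams) (n : ℕ) (Ω Λ : ℕ → Set (Site (F.P p'.K) 0)) (j : ℕ) (Λ' : Set (Site (F.P p'.K) 0)) (ω : MultiCfg (F.P p'.K) (SU N) (FluctV N)),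
      (θ.Zh p' n Ω Λ).quad j Λ' ω = ∑ b ∈ (Set.toFinite (bondsIn j (Λ'ᶜ ∩ Ω (j + 1)))).toFinset, ‖(ω j).2 b‖ ^ 2)
    (h : θ.Provisos₁₃SepCoPH F N) (hsel : θ.ppSel = ppSelLiveOfRecord F N θ.ν θ.τ9 (EOfRecord₁₃ F N θ.toStage13Params) (wOfRecord₉ F N θ.toStage9Params))
    (hθ : θ.Admissible F N) (hκ : 0 ≤ θ.s2.lf.κ) (hE₀ : 0 ≤ θ.s2.lf.E₀) (hB₀ : 0 ≤ θ.s2.lf.B₀)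
    (hM₁ : 0 < θ.ν.M₁) (hle : θ.ν.M₁ ≤ θ.τ9.M) (hcR : 2 ≤ θ.s2.cR) (hdiv : F.L * θ.ν.M₂ ∣ θ.τ9.M) {a : ℕ} (hMa : θ.τ9.M = F.L ^ a) (hr : θ.ν.r = 1)
    (h3 : ∀ j, 1 ≤ j → j ≤ p.K →
      3 * side (F.P p.K).L θ.ν.M₁ j ≤ cubeSide (F.P p.K).L θ.ν.M₂ (RkOfRecord (F.P p.K).L θ.ν.r (gOfRecord₁₃ F N θ.toStage13Params p j)) j)
    (hR : ∀ j, 1 ≤ j → j ≤ p.K → (F.P p.K).L ^ j + (((F.P p.K).d + 4) * (F.P p.K).L + 2) * (∑ l ∈ Finset.range j, (F.P p.K).L ^ l) + 2 ≤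
      cubeSide (F.P p.K).L θ.ν.M₂ (RkOfRecord (F.P p.K).L θ.ν.r (gOfRecord₁₃ F N θ.toStage13Params p j)) j)
    (hε : ∀ j, 1 ≤ j → j ≤ p.K → 0 < epsOfRecord θ.ν (gOfRecord₁₃ F N θ.toStage13Params p) j)
    (hε3 : ∀ j, 1 ≤ j → j ≤ p.K → (143 * (((((F.P p.K).d + 4 : ℕ) : ℝ)) ^ 2 / 4) ^ 2) * epsOfRecord θ.ν (gOfRecord₁₃ F N θ.toStage13Params p) j ≤ 1 / 3)
    (hε2 : ∀ j, 1 ≤ j → j ≤ p.K →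
      2 * epsOfRecord θ.ν (gOfRecord₁₃ F N θ.toStage13Params p) j ≤ 2 * ExpMeanLog.deltaSU (Fin N) / ((((F.P p.K).d + 4) * (F.P p.K).L : ℕ) : ℝ) ^ 2)
    (hsolv : ∀ j, 1 ≤ j → j ≤ p.K → ∀ (s : SeqOfRecord F θ.ν θ.τ9.M (gOfRecord₁₃ F N θ.toStage13Params p) p.K j) (V : GaugeField (F.P p.K) j (SU N)),
      chiSeqOfRecord F N θ.ν θ.τ9.M (gOfRecord₁₃ F N θ.toStage13Params p) p.K j s V ≠ 0 →
      ∀ a ∈ cubesIn (fun a : ↥(cubeIndices (F.P p.K) (cubeSide (F.P p.K).L θ.ν.M₂ (RkOfRecord (F.P p.K).L θ.ν.r (gOfRecord₁₃ F N θ.toStage13Params p j)) j)) =>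
          cubeEnl (F.P p.K) (cubeSide (F.P p.K).L θ.ν.M₂ (RkOfRecord (F.P p.K).L θ.ν.r (gOfRecord₁₃ F N θ.toStage13Params p j)) j) a 0) (s.Ω j),
        ∃ U₀, IsMinimizer (avOfRecord F N p.K) {U | PlaqSmall (θ.ν.εreg * (F.P p.K).eta j ^ 2) U}
          (Bj θ.ν.M₁ (cubeEnl (F.P p.K) (cubeSide (F.P p.K).L θ.ν.M₂ (RkOfRecord (F.P p.K).L θ.ν.r (gOfRecord₁₃ F N θ.toStage13Params p j)) j) a 4) j)
          (avgFamily (avOfRecord F N p.K) (qsstarGIter0 j V)) U₀)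
    (σ : Sect3Supplier θ p) (hσ : SupplierObligations θ p σ) (hσB : SupplierBorel θ p σ)
    (hCD : ∀ n₀, n₀ ≤ p.K → PartCompat₁₃ F N θ.toStage13Params p n₀ →
      (∀ j, n₀ < j → j ≤ p.K →
        (F.P p.K).sitesPerDir 0 < dCubeSide (F.P p.K).L θ.τ9.M (RkOfRecord (F.P p.K).L θ.ν.r (gOfRecord₁₃ F N θ.toStage13Params p j)) j) →
      -- (C) global regularity of the all-small histories of the one-block tail
      (∀ m, n₀ < m → m ≤ p.K → ∀ (s : SeqOfRecord F θ.ν θ.τ9.M (gOfRecord₁₃ F N θ.toStage13Params p) p.K m) (W : MSField (F.P p.K) (SU N)),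
        W ∈ suppOfRecord₁₃SepCoP F N θ.toStage13Params p m s →
        ∀ j, 1 ≤ j → j ≤ m → (∀ i, 1 ≤ i → i ≤ j → s.Ω i = Set.univ ∧ s.Λ i = Set.univ) → ∀ X : (Sect2.domSys (F.P p.K) θ.τ9.M j).Dom,
          Sect2.ofBackgroundC (settingOfRecord₁₃ F N θ.toStage13Params p).ι (UbgOfRecord₁₃CoP F N θ.toStage13Params p m s W) ∈
            Sect2.spaceI (settingOfRecord₁₃ F N θ.toStage13Params p) (θ.Rz p.K) θ.τ9.M j (Sect2.domSites (F.P p.K) θ.τ9.M j X)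
              ((settingOfRecord₁₃ F N θ.toStage13Params p).lf.alpha0 ((settingOfRecord₁₃ F N θ.toStage13Params p).flow.g j))
              ((settingOfRecord₁₃ F N θ.toStage13Params p).lf.alpha1 ((settingOfRecord₁₃ F N θ.toStage13Params p).flow.g j))) ∧
      -- (D) the large-field space at the switch levels of the one-block tail
      (∀ m, n₀ < m → m ≤ p.K → ∀ (s : SeqOfRecord F θ.ν θ.τ9.M (gOfRecord₁₃ F N θ.toStage13Params p) p.K m) (W : MSField (F.P p.K) (SU N)),
        W ∈ suppOfRecord₁₃SepCoP F N θ.toStage13Params p m s →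
        ∀ j, n₀ < j → j ≤ m → (∀ i, 1 ≤ i → i < j → s.Ω i = Set.univ ∧ s.Λ i = Set.univ) → s.Ω j = Set.univ → s.Λ j = ∅ →
          (∀ i, j < i → i ≤ m → s.Ω i = ∅ ∧ s.Λ i = ∅) → ∀ X : (Sect2.domSys (F.P p.K) θ.τ9.M j).Dom,
            Sect2.ofBackgroundC (settingOfRecord₁₃ F N θ.toStage13Params p).ι (UbgOfRecord₁₃CoP F N θ.toStage13Params p m s W) ∈
              Sect2.spaceMS (settingOfRecord₁₃ F N θ.toStage13Params p) (θ.Rz p.K) θ.τ9.M j (Sect2.domSites (F.P p.K) θ.τ9.M j X) s.Ω))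
    (w : WorldP) (hC : w.C = (datumOfRecord₁₃SepCoPH F N θ h).C) (hγw : w.γ ≤ θ.γ) (hβ : 0 ≤ w.βup) (hβγ : w.βup * w.γ ^ 2 ≤ 1) :
    Dag.B14_main (leavesP w p) :=
  b14_main_leavesP_of_supplyChainAt_of_window_of_flowIneq26 h hsel hθ hκ hE₀ hB₀ w hC p fun hw h26 =>
    supplyChainAt_of_gaussCert_of_supplierBorel_of_bgFacts_of_powM θ p hζ hq h.toCore hθ hM₁ hle hcR
      (fun j hj => ⟨(hw j hj).1, (hw j hj).2.trans hγw⟩)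
      (bgProvisoΛ_family_atRecord_of_provisos₁₃SepCoPH_of_flowIneq26 θ p h hr hβ hβγ hγw hw h26 hCD) hdiv hMa h3 hR hε hε3 hε2 hsolv σ hσ hσB


end PerRun

/-! ## §2  Every run of the world (rows keyed on the window `]0, θ.γ]`, as dag-n11-w1's H5 ∕ FILE 6) -/

section AllRuns

variable (θ : Stage13HParams F N)

/-- **★★★ N11's NODE AT EVERY RUN OF THE WORLD ON THE SupplierBorel ROAD — bg FACTS FROM THE TAIL SUPPLIERS (C) ∕ (D), NO GUARD BINDER, NO bg BINDER, NO ONE-BLOCK PRODUCER** (rows keyed on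
the window `]0, θ.γ]`; world `w.γ ≤ θ.γ`, `0 ≤ w.βup`, `w.βup·w.γ² ≤ 1`): the N11 conjunct of `Nodes (leavesP w P)` that K1⁹'s assembly reads, on this road, with the bg content asked ONLY
as global regularity of the all-small tail histories and the large-field space at their switch levels. [cite: Balaban1988Convergent, Thm 1 p.262, Theorem p.245, p.244 L36–38, §3 p.279,
(2.5)–(2.6) p.255, p.257, (2.28) p.259, (3.24)–(3.25) p.270; Balaban1987RG1, Thm 1 p.259, (0.20) p.256; Balaban1985Variational, Thm 1 (7)–(8) pp.278–279] -/
theorem b14_main_leavesP_all_of_gaussCert_of_supplierBorel_of_tailSuppliers_of_powM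
    (hζ : ∀ (p : B12.RunParams) (n : ℕ) (Ω Λ : ℕ → Set (Site (F.P p.K) 0)), (θ.Zh p n Ω Λ).ζ0 = (ZhPinOfRecord₁₃ θ.toStage13Params p Ω Λ).ζ0)
    (hq : ∀ (p : B12.RunParams) (n : ℕ) (Ω Λ : ℕ → Set (Site (F.P p.K) 0)) (j : ℕ) (Λ' : Set (Site (F.P p.K) 0)) (ω : MultiCfg (F.P p.K) (SU N) (FluctV N)),
      (θ.Zh p n Ω Λ).quad j Λ' ω = ∑ b ∈ (Set.toFinite (bondsIn j (Λ'ᶜ ∩ Ω (j + 1)))).toFinset, ‖(ω j).2 b‖ ^ 2)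
    (h : θ.Provisos₁₃SepCoPH F N) (hsel : θ.ppSel = ppSelLiveOfRecord F N θ.ν θ.τ9 (EOfRecord₁₃ F N θ.toStage13Params) (wOfRecord₉ F N θ.toStage9Params))
    (hθ : θ.Admissible F N) (hκ : 0 ≤ θ.s2.lf.κ) (hE₀ : 0 ≤ θ.s2.lf.E₀) (hB₀ : 0 ≤ θ.s2.lf.B₀)
    (hM₁ : 0 < θ.ν.M₁) (hle : θ.ν.M₁ ≤ θ.τ9.M) (hcR : 2 ≤ θ.s2.cR) (hdiv : F.L * θ.ν.M₂ ∣ θ.τ9.M) {a : ℕ} (hMa : θ.τ9.M = F.L ^ a) (hr : θ.ν.r = 1)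
    (h3 : ∀ P : B12.RunParams, Step.InInterval θ.γ P.K (gOfRecord₁₃ F N θ.toStage13Params P) → ∀ j, 1 ≤ j → j ≤ P.K →
      3 * side (F.P P.K).L θ.ν.M₁ j ≤ cubeSide (F.P P.K).L θ.ν.M₂ (RkOfRecord (F.P P.K).L θ.ν.r (gOfRecord₁₃ F N θ.toStage13Params P j)) j)
    (hR : ∀ P : B12.RunParams, Step.InInterval θ.γ P.K (gOfRecord₁₃ F N θ.toStage13Params P) → ∀ j, 1 ≤ j → j ≤ P.K →
      (F.P P.K).L ^ j + (((F.P P.K).d + 4) * (F.P P.K).L + 2) * (∑ l ∈ Finset.range j, (F.P P.K).L ^ l) + 2 ≤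
        cubeSide (F.P P.K).L θ.ν.M₂ (RkOfRecord (F.P P.K).L θ.ν.r (gOfRecord₁₃ F N θ.toStage13Params P j)) j)
    (hε : ∀ P : B12.RunParams, Step.InInterval θ.γ P.K (gOfRecord₁₃ F N θ.toStage13Params P) → ∀ j, 1 ≤ j → j ≤ P.K →
      0 < epsOfRecord θ.ν (gOfRecord₁₃ F N θ.toStage13Params P) j)
    (hε3 : ∀ P : B12.RunParams, Step.InInterval θ.γ P.K (gOfRecord₁₃ F N θ.toStage13Params P) → ∀ j, 1 ≤ j → j ≤ P.K →
      (143 * (((((F.P P.K).d + 4 : ℕ) : ℝ)) ^ 2 / 4) ^ 2) * epsOfRecord θ.ν (gOfRecord₁₃ F N θ.toStage13Params P) j ≤ 1 / 3)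
    (hε2 : ∀ P : B12.RunParams, Step.InInterval θ.γ P.K (gOfRecord₁₃ F N θ.toStage13Params P) → ∀ j, 1 ≤ j → j ≤ P.K →
      2 * epsOfRecord θ.ν (gOfRecord₁₃ F N θ.toStage13Params P) j ≤ 2 * ExpMeanLog.deltaSU (Fin N) / ((((F.P P.K).d + 4) * (F.P P.K).L : ℕ) : ℝ) ^ 2)
    (hsolv : ∀ P : B12.RunParams, Step.InInterval θ.γ P.K (gOfRecord₁₃ F N θ.toStage13Params P) → ∀ j, 1 ≤ j → j ≤ P.K →
      ∀ (s : SeqOfRecord F θ.ν θ.τ9.M (gOfRecord₁₃ F N θ.toStage13Params P) P.K j) (V : GaugeField (F.P P.K) j (SU N)),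
      chiSeqOfRecord F N θ.ν θ.τ9.M (gOfRecord₁₃ F N θ.toStage13Params P) P.K j s V ≠ 0 →
      ∀ a ∈ cubesIn (fun a : ↥(cubeIndices (F.P P.K) (cubeSide (F.P P.K).L θ.ν.M₂ (RkOfRecord (F.P P.K).L θ.ν.r (gOfRecord₁₃ F N θ.toStage13Params P j)) j)) =>
          cubeEnl (F.P P.K) (cubeSide (F.P P.K).L θ.ν.M₂ (RkOfRecord (F.P P.K).L θ.ν.r (gOfRecord₁₃ F N θ.toStage13Params P j)) j) a 0) (s.Ω j),
        ∃ U₀, IsMinimizer (avOfRecord F N P.K) {U | PlaqSmall (θ.ν.εreg * (F.P P.K).eta j ^ 2) U}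
          (Bj θ.ν.M₁ (cubeEnl (F.P P.K) (cubeSide (F.P P.K).L θ.ν.M₂ (RkOfRecord (F.P P.K).L θ.ν.r (gOfRecord₁₃ F N θ.toStage13Params P j)) j) a 4) j)
          (avgFamily (avOfRecord F N P.K) (qsstarGIter0 j V)) U₀)
    (σ : (P : B12.RunParams) → Sect3Supplier θ P)
    (hσ : ∀ P : B12.RunParams, Step.InInterval θ.γ P.K (gOfRecord₁₃ F N θ.toStage13Params P) → SupplierObligations θ P (σ P))
    (hσB : ∀ P : B12.RunParams, Step.InInterval θ.γ P.K (gOfRecord₁₃ F N θ.toStage13Params P) → SupplierBorel θ P (σ P))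
    (hCD : ∀ P : B12.RunParams, Step.InInterval θ.γ P.K (gOfRecord₁₃ F N θ.toStage13Params P) →
      ∀ n₀, n₀ ≤ P.K → PartCompat₁₃ F N θ.toStage13Params P n₀ →
        (∀ j, n₀ < j → j ≤ P.K →
          (F.P P.K).sitesPerDir 0 < dCubeSide (F.P P.K).L θ.τ9.M (RkOfRecord (F.P P.K).L θ.ν.r (gOfRecord₁₃ F N θ.toStage13Params P j)) j) →
        -- (C) global regularity of the all-small histories of the one-block tail
        (∀ m, n₀ < m → m ≤ P.K → ∀ (s : SeqOfRecord F θ.ν θ.τ9.M (gOfRecord₁₃ F N θ.toStage13Params P) P.K m) (W : MSField (F.P P.K) (SU N)),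
          W ∈ suppOfRecord₁₃SepCoP F N θ.toStage13Params P m s →
          ∀ j, 1 ≤ j → j ≤ m → (∀ i, 1 ≤ i → i ≤ j → s.Ω i = Set.univ ∧ s.Λ i = Set.univ) → ∀ X : (Sect2.domSys (F.P P.K) θ.τ9.M j).Dom,
            Sect2.ofBackgroundC (settingOfRecord₁₃ F N θ.toStage13Params P).ι (UbgOfRecord₁₃CoP F N θ.toStage13Params P m s W) ∈
              Sect2.spaceI (settingOfRecord₁₃ F N θ.toStage13Params P) (θ.Rz P.K) θ.τ9.M j (Sect2.domSites (F.P P.K) θ.τ9.M j X)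
                ((settingOfRecord₁₃ F N θ.toStage13Params P).lf.alpha0 ((settingOfRecord₁₃ F N θ.toStage13Params P).flow.g j))
                ((settingOfRecord₁₃ F N θ.toStage13Params P).lf.alpha1 ((settingOfRecord₁₃ F N θ.toStage13Params P).flow.g j))) ∧
        -- (D) the large-field space at the switch levels of the one-block tail
        (∀ m, n₀ < m → m ≤ P.K → ∀ (s : SeqOfRecord F θ.ν θ.τ9.M (gOfRecord₁₃ F N θ.toStage13Params P) P.K m) (W : MSField (F.P P.K) (SU N)),
          W ∈ suppOfRecord₁₃SepCoP F N θ.toStage13Params P m s →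
          ∀ j, n₀ < j → j ≤ m → (∀ i, 1 ≤ i → i < j → s.Ω i = Set.univ ∧ s.Λ i = Set.univ) → s.Ω j = Set.univ → s.Λ j = ∅ →
            (∀ i, j < i → i ≤ m → s.Ω i = ∅ ∧ s.Λ i = ∅) → ∀ X : (Sect2.domSys (F.P P.K) θ.τ9.M j).Dom,
              Sect2.ofBackgroundC (settingOfRecord₁₃ F N θ.toStage13Params P).ι (UbgOfRecord₁₃CoP F N θ.toStage13Params P m s W) ∈
                Sect2.spaceMS (settingOfRecord₁₃ F N θ.toStage13Params P) (θ.Rz P.K) θ.τ9.M j (Sect2.domSites (F.P P.K) θ.τ9.M j X) s.Ω))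
    (w : WorldP) (hC : w.C = (datumOfRecord₁₃SepCoPH F N θ h).C) (hγw : w.γ ≤ θ.γ) (hβ : 0 ≤ w.βup) (hβγ : w.βup * w.γ ^ 2 ≤ 1) :
    ∀ P : B12.RunParams, Dag.B14_main (leavesP w P) := fun P =>
  b14_main_leavesP_of_supplyChainAt_of_window_of_flowIneq26 h hsel hθ hκ hE₀ hB₀ w hC P fun hw h26 =>
    have hW : Step.InInterval θ.γ P.K (gOfRecord₁₃ F N θ.toStage13Params P) := fun j hj => ⟨(hw j hj).1, (hw j hj).2.trans hγw⟩
    supplyChainAt_of_gaussCert_of_supplierBorel_of_bgFacts_of_powM θ P hζ hq h.toCore hθ hM₁ hle hcR hW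
      (bgProvisoΛ_family_atRecord_of_provisos₁₃SepCoPH_of_flowIneq26 θ P h hr hβ hβγ hγw hw h26 (hCD P hW)) hdiv hMa (h3 P hW) (hR P hW)
      (hε P hW) (hε3 P hW) (hε2 P hW) (hsolv P hW) (σ P) (hσ P hW) (hσB P hW)


end AllRuns

/-! ## §3  The edition at the NAMED Gaussian certificate `gaussPinH θ` — no class hypothesis -/

section Named

variable (θ : Stage13HParams F N)

/-- **★★ N11's NODE AT EVERY RUN AT A WORLD BOUND TO THE K1-KEYED DATUM OF `gaussPinH θ` — bg FACTS FROM THE TAIL SUPPLIERS** (§2 with `gaussPinH_ζ0 ∕ gaussPinH_quad` (`rfl`) and the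
key by `provisos₁₃SepCoPH_gaussPinH`; rows over `θ`'s Stage-13 letters, as dag-n11-w1's §4). [cite: Balaban1988Convergent, Thm 1 p.262, Theorem p.245, §3 p.279, (2.6) p.255, p.257, (2.28) p.259;
Balaban1987RG1, Thm 1 p.259; Balaban1985Variational, Thm 1 (7)–(8) pp.278–279] -/
theorem b14_main_leavesP_all_gaussPinH_of_supplierBorel_of_tailSuppliers_of_powM
    (h : θ.Provisos₁₃SepCoPH F N) (hsel : θ.ppSel = ppSelLiveOfRecord F N θ.ν θ.τ9 (EOfRecord₁₃ F N θ.toStage13Params) (wOfRecord₉ F N θ.toStage9Params))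
    (hθ : θ.Admissible F N) (hκ : 0 ≤ θ.s2.lf.κ) (hE₀ : 0 ≤ θ.s2.lf.E₀) (hB₀ : 0 ≤ θ.s2.lf.B₀)
    (hM₁ : 0 < θ.ν.M₁) (hle : θ.ν.M₁ ≤ θ.τ9.M) (hcR : 2 ≤ θ.s2.cR) (hdiv : F.L * θ.ν.M₂ ∣ θ.τ9.M) {a : ℕ} (hMa : θ.τ9.M = F.L ^ a) (hr : θ.ν.r = 1)
    (h3 : ∀ P : B12.RunParams, Step.InInterval θ.γ P.K (gOfRecord₁₃ F N θ.toStage13Params P) → ∀ j, 1 ≤ j → j ≤ P.K →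
      3 * side (F.P P.K).L θ.toStage13Params.ν.M₁ j ≤ cubeSide (F.P P.K).L θ.toStage13Params.ν.M₂ (RkOfRecord (F.P P.K).L θ.toStage13Params.ν.r (gOfRecord₁₃ F N θ.toStage13Params P j)) j)
    (hR : ∀ P : B12.RunParams, Step.InInterval θ.γ P.K (gOfRecord₁₃ F N θ.toStage13Params P) → ∀ j, 1 ≤ j → j ≤ P.K →
      (F.P P.K).L ^ j + (((F.P P.K).d + 4) * (F.P P.K).L + 2) * (∑ l ∈ Finset.range j, (F.P P.K).L ^ l) + 2 ≤
        cubeSide (F.P P.K).L θ.toStage13Params.ν.M₂ (RkOfRecord (F.P P.K).L θ.toStage13Params.ν.r (gOfRecord₁₃ F N θ.toStage13Params P j)) j)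
    (hε : ∀ P : B12.RunParams, Step.InInterval θ.γ P.K (gOfRecord₁₃ F N θ.toStage13Params P) → ∀ j, 1 ≤ j → j ≤ P.K →
      0 < epsOfRecord θ.toStage13Params.ν (gOfRecord₁₃ F N θ.toStage13Params P) j)
    (hε3 : ∀ P : B12.RunParams, Step.InInterval θ.γ P.K (gOfRecord₁₃ F N θ.toStage13Params P) → ∀ j, 1 ≤ j → j ≤ P.K →
      (143 * (((((F.P P.K).d + 4 : ℕ) : ℝ)) ^ 2 / 4) ^ 2) * epsOfRecord θ.toStage13Params.ν (gOfRecord₁₃ F N θ.toStage13Params P) j ≤ 1 / 3)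
    (hε2 : ∀ P : B12.RunParams, Step.InInterval θ.γ P.K (gOfRecord₁₃ F N θ.toStage13Params P) → ∀ j, 1 ≤ j → j ≤ P.K →
      2 * epsOfRecord θ.toStage13Params.ν (gOfRecord₁₃ F N θ.toStage13Params P) j ≤ 2 * ExpMeanLog.deltaSU (Fin N) / ((((F.P P.K).d + 4) * (F.P P.K).L : ℕ) : ℝ) ^ 2)
    (hsolv : ∀ P : B12.RunParams, Step.InInterval θ.γ P.K (gOfRecord₁₃ F N θ.toStage13Params P) → ∀ j, 1 ≤ j → j ≤ P.K →
      ∀ (s : SeqOfRecord F θ.toStage13Params.ν θ.toStage13Params.τ9.M (gOfRecord₁₃ F N θ.toStage13Params P) P.K j) (V : GaugeField (F.P P.K) j (SU N)),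
      chiSeqOfRecord F N θ.toStage13Params.ν θ.toStage13Params.τ9.M (gOfRecord₁₃ F N θ.toStage13Params P) P.K j s V ≠ 0 →
      ∀ a ∈ cubesIn (fun a : ↥(cubeIndices (F.P P.K) (cubeSide (F.P P.K).L θ.toStage13Params.ν.M₂ (RkOfRecord (F.P P.K).L θ.toStage13Params.ν.r (gOfRecord₁₃ F N θ.toStage13Params P j)) j)) =>
          cubeEnl (F.P P.K) (cubeSide (F.P P.K).L θ.toStage13Params.ν.M₂ (RkOfRecord (F.P P.K).L θ.toStage13Params.ν.r (gOfRecord₁₃ F N θ.toStage13Params P j)) j) a 0) (s.Ω j),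
        ∃ U₀, IsMinimizer (avOfRecord F N P.K) {U | PlaqSmall (θ.toStage13Params.ν.εreg * (F.P P.K).eta j ^ 2) U}
          (Bj θ.toStage13Params.ν.M₁ (cubeEnl (F.P P.K) (cubeSide (F.P P.K).L θ.toStage13Params.ν.M₂ (RkOfRecord (F.P P.K).L θ.toStage13Params.ν.r (gOfRecord₁₃ F N θ.toStage13Params P j)) j) a 4) j)
          (avgFamily (avOfRecord F N P.K) (qsstarGIter0 j V)) U₀)
    (σ : (P : B12.RunParams) → Sect3Supplier (gaussPinH θ) P)
    (hσ : ∀ P : B12.RunParams, Step.InInterval θ.γ P.K (gOfRecord₁₃ F N θ.toStage13Params P) → SupplierObligations (gaussPinH θ) P (σ P))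
    (hσB : ∀ P : B12.RunParams, Step.InInterval θ.γ P.K (gOfRecord₁₃ F N θ.toStage13Params P) → SupplierBorel (gaussPinH θ) P (σ P))
    (hCD : ∀ P : B12.RunParams, Step.InInterval θ.γ P.K (gOfRecord₁₃ F N θ.toStage13Params P) →
      ∀ n₀, n₀ ≤ P.K → PartCompat₁₃ F N θ.toStage13Params P n₀ →
        (∀ j, n₀ < j → j ≤ P.K →
          (F.P P.K).sitesPerDir 0 < dCubeSide (F.P P.K).L θ.toStage13Params.τ9.M (RkOfRecord (F.P P.K).L θ.toStage13Params.ν.r (gOfRecord₁₃ F N θ.toStage13Params P j)) j) →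
        -- (C) global regularity of the all-small histories of the one-block tail
        (∀ m, n₀ < m → m ≤ P.K → ∀ (s : SeqOfRecord F θ.toStage13Params.ν θ.toStage13Params.τ9.M (gOfRecord₁₃ F N θ.toStage13Params P) P.K m) (W : MSField (F.P P.K) (SU N)),
          W ∈ suppOfRecord₁₃SepCoP F N θ.toStage13Params P m s →
          ∀ j, 1 ≤ j → j ≤ m → (∀ i, 1 ≤ i → i ≤ j → s.Ω i = Set.univ ∧ s.Λ i = Set.univ) → ∀ X : (Sect2.domSys (F.P P.K) θ.toStage13Params.τ9.M j).Dom,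
            Sect2.ofBackgroundC (settingOfRecord₁₃ F N θ.toStage13Params P).ι (UbgOfRecord₁₃CoP F N θ.toStage13Params P m s W) ∈
              Sect2.spaceI (settingOfRecord₁₃ F N θ.toStage13Params P) (θ.Rz P.K) θ.toStage13Params.τ9.M j (Sect2.domSites (F.P P.K) θ.toStage13Params.τ9.M j X)
                ((settingOfRecord₁₃ F N θ.toStage13Params P).lf.alpha0 ((settingOfRecord₁₃ F N θ.toStage13Params P).flow.g j))
                ((settingOfRecord₁₃ F N θ.toStage13Params P).lf.alpha1 ((settingOfRecord₁₃ F N θ.toStage13Params P).flow.g j))) ∧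
        -- (D) the large-field space at the switch levels of the one-block tail
        (∀ m, n₀ < m → m ≤ P.K → ∀ (s : SeqOfRecord F θ.toStage13Params.ν θ.toStage13Params.τ9.M (gOfRecord₁₃ F N θ.toStage13Params P) P.K m) (W : MSField (F.P P.K) (SU N)),
          W ∈ suppOfRecord₁₃SepCoP F N θ.toStage13Params P m s →
          ∀ j, n₀ < j → j ≤ m → (∀ i, 1 ≤ i → i < j → s.Ω i = Set.univ ∧ s.Λ i = Set.univ) → s.Ω j = Set.univ → s.Λ j = ∅ →
            (∀ i, j < i → i ≤ m → s.Ω i = ∅ ∧ s.Λ i = ∅) → ∀ X : (Sect2.domSys (F.P P.K) θ.toStage13Params.τ9.M j).Dom,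
              Sect2.ofBackgroundC (settingOfRecord₁₃ F N θ.toStage13Params P).ι (UbgOfRecord₁₃CoP F N θ.toStage13Params P m s W) ∈
                Sect2.spaceMS (settingOfRecord₁₃ F N θ.toStage13Params P) (θ.Rz P.K) θ.toStage13Params.τ9.M j (Sect2.domSites (F.P P.K) θ.toStage13Params.τ9.M j X) s.Ω))
    (w : WorldP) (hC : w.C = (datumOfRecord₁₃SepCoPH F N (gaussPinH θ) (provisos₁₃SepCoPH_gaussPinH h)).C) (hγw : w.γ ≤ θ.γ) (hβ : 0 ≤ w.βup)
    (hβγ : w.βup * w.γ ^ 2 ≤ 1) : ∀ P : B12.RunParams, Dag.B14_main (leavesP w P) :=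
  b14_main_leavesP_all_of_gaussCert_of_supplierBorel_of_tailSuppliers_of_powM (gaussPinH θ) (gaussPinH_ζ0 θ) (gaussPinH_quad θ) (provisos₁₃SepCoPH_gaussPinH h) hsel
    hθ hκ hE₀ hB₀ hM₁ hle hcR hdiv hMa hr h3 hR hε hε3 hε2 hsolv σ hσ hσB hCD w hC hγw hβ hβγ


end Named


/-! ## §4  The PRINTED face at the K1-keyed datum (dag-n11-w1's `…Sect3SupplyChainBorelBThm1PrintedOfBgFacts` with `hbgs` ↦ (2.6) along the windowed runs + the tail suppliers) -/

section Printed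

variable (θ : Stage13HParams F N)

/-- **★★★ `B16.Thm1Printed (datumOfRecord₁₃SepCoPH θ h).C` FOR A GAUSSIAN-CLASS `θ` WITH THE SEPARATED-RANGE KEY — bg FACTS FROM THE TAIL SUPPLIERS** (dag-n11-w1's K1-keyed printed face,
its binder `hbgs` REPLACED by: [III] (2.6) along every `γ`-windowed run with one ceiling pair `(β⁺, β₀)`, `0 ≤ β⁺`, `β⁺·γ² ≤ 1`, `γ ≤ θ.γ`, `r = 1` — on the NODE road (2.6) is N11's own
antecedent, on this PRINTED road it is a DISPLAYED letter of print ([III] p.255) — and the tail suppliers `hCD` = (C) ∧ (D) keyed on the window `]0, γ]`; every other row VERBATIM).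
[cite: Balaban1988Convergent, Thm 1 p.262, Theorem p.245, §3 p.279, (0.2) p.244, (2.6) p.255, (2.28) p.259; Balaban1989LargeFieldII, Thm 1 p.355; Balaban1989LargeFieldI, (0.3)–(0.4) p.176] -/
theorem thm1Printed_datumOfRecord₁₃SepCoPH_of_gaussCert_of_supplierBorel_of_tailSuppliers_of_powM
    (hζ : ∀ (p : B12.RunParams) (n : ℕ) (Ω Λ : ℕ → Set (Site (F.P p.K) 0)), (θ.Zh p n Ω Λ).ζ0 = (ZhPinOfRecord₁₃ θ.toStage13Params p Ω Λ).ζ0)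
    (hq : ∀ (p : B12.RunParams) (n : ℕ) (Ω Λ : ℕ → Set (Site (F.P p.K) 0)) (j : ℕ) (Λ' : Set (Site (F.P p.K) 0)) (ω : MultiCfg (F.P p.K) (SU N) (FluctV N)),
      (θ.Zh p n Ω Λ).quad j Λ' ω = ∑ b ∈ (Set.toFinite (bondsIn j (Λ'ᶜ ∩ Ω (j + 1)))).toFinset, ‖(ω j).2 b‖ ^ 2)
    (h : θ.Provisos₁₃SepCoPH F N) (hsel : θ.ppSel = ppSelLiveOfRecord F N θ.ν θ.τ9 (EOfRecord₁₃ F N θ.toStage13Params) (wOfRecord₉ F N θ.toStage9Params))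
    (hθ : θ.Admissible F N) (hκ : 0 ≤ θ.s2.lf.κ) (hE₀ : 0 ≤ θ.s2.lf.E₀) (hB₀ : 0 ≤ θ.s2.lf.B₀)
    (hM₁ : 0 < θ.ν.M₁) (hle : θ.ν.M₁ ≤ θ.τ9.M) (hcR : 2 ≤ θ.s2.cR) {γ : ℝ} (hγ : 0 < γ)
    (hr : θ.ν.r = 1) {βup β₀ : ℝ} (hβ : 0 ≤ βup) (hβγ : βup * γ ^ 2 ≤ 1) (hγθ : γ ≤ θ.γ)
    (h26 : ∀ P : B12.RunParams, Step.InInterval γ P.K (gOfRecord₁₃ F N θ.toStage13Params P) →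
      B14.FlowIneq26 (gOfRecord₁₃ F N θ.toStage13Params P) βup β₀ P.K)
    (hCD : ∀ P : B12.RunParams, Step.InInterval γ P.K (gOfRecord₁₃ F N θ.toStage13Params P) →
      ∀ n₀, n₀ ≤ P.K → PartCompat₁₃ F N θ.toStage13Params P n₀ →
      (∀ j, n₀ < j → j ≤ P.K →
        (F.P P.K).sitesPerDir 0 < dCubeSide (F.P P.K).L θ.τ9.M (RkOfRecord (F.P P.K).L θ.ν.r (gOfRecord₁₃ F N θ.toStage13Params P j)) j) →
      -- (C) global regularity of the all-small histories of the one-block tail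
      (∀ m, n₀ < m → m ≤ P.K → ∀ (s : SeqOfRecord F θ.ν θ.τ9.M (gOfRecord₁₃ F N θ.toStage13Params P) P.K m) (W : MSField (F.P P.K) (SU N)),
        W ∈ suppOfRecord₁₃SepCoP F N θ.toStage13Params P m s →
        ∀ j, 1 ≤ j → j ≤ m → (∀ i, 1 ≤ i → i ≤ j → s.Ω i = Set.univ ∧ s.Λ i = Set.univ) → ∀ X : (Sect2.domSys (F.P P.K) θ.τ9.M j).Dom,
          Sect2.ofBackgroundC (settingOfRecord₁₃ F N θ.toStage13Params P).ι (UbgOfRecord₁₃CoP F N θ.toStage13Params P m s W) ∈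
            Sect2.spaceI (settingOfRecord₁₃ F N θ.toStage13Params P) (θ.Rz P.K) θ.τ9.M j (Sect2.domSites (F.P P.K) θ.τ9.M j X)
              ((settingOfRecord₁₃ F N θ.toStage13Params P).lf.alpha0 ((settingOfRecord₁₃ F N θ.toStage13Params P).flow.g j))
              ((settingOfRecord₁₃ F N θ.toStage13Params P).lf.alpha1 ((settingOfRecord₁₃ F N θ.toStage13Params P).flow.g j))) ∧
      -- (D) the large-field space at the switch levels of the one-block tail
      (∀ m, n₀ < m → m ≤ P.K → ∀ (s : SeqOfRecord F θ.ν θ.τ9.M (gOfRecord₁₃ F N θ.toStage13Params P) P.K m) (W : MSField (F.P P.K) (SU N)),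
        W ∈ suppOfRecord₁₃SepCoP F N θ.toStage13Params P m s →
        ∀ j, n₀ < j → j ≤ m → (∀ i, 1 ≤ i → i < j → s.Ω i = Set.univ ∧ s.Λ i = Set.univ) → s.Ω j = Set.univ → s.Λ j = ∅ →
          (∀ i, j < i → i ≤ m → s.Ω i = ∅ ∧ s.Λ i = ∅) → ∀ X : (Sect2.domSys (F.P P.K) θ.τ9.M j).Dom,
            Sect2.ofBackgroundC (settingOfRecord₁₃ F N θ.toStage13Params P).ι (UbgOfRecord₁₃CoP F N θ.toStage13Params P m s W) ∈
              Sect2.spaceMS (settingOfRecord₁₃ F N θ.toStage13Params P) (θ.Rz P.K) θ.τ9.M j (Sect2.domSites (F.P P.K) θ.τ9.M j X) s.Ω))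
    (hdiv : F.L * θ.ν.M₂ ∣ θ.τ9.M) {a : ℕ} (hMa : θ.τ9.M = F.L ^ a)
    (h3 : ∀ P : B12.RunParams, Step.InInterval γ P.K (gOfRecord₁₃ F N θ.toStage13Params P) → ∀ j, 1 ≤ j → j ≤ P.K →
      3 * side (F.P P.K).L θ.ν.M₁ j ≤ cubeSide (F.P P.K).L θ.ν.M₂ (RkOfRecord (F.P P.K).L θ.ν.r (gOfRecord₁₃ F N θ.toStage13Params P j)) j)
    (hR : ∀ P : B12.RunParams, Step.InInterval γ P.K (gOfRecord₁₃ F N θ.toStage13Params P) → ∀ j, 1 ≤ j → j ≤ P.K →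
      (F.P P.K).L ^ j + (((F.P P.K).d + 4) * (F.P P.K).L + 2) * (∑ l ∈ Finset.range j, (F.P P.K).L ^ l) + 2 ≤
        cubeSide (F.P P.K).L θ.ν.M₂ (RkOfRecord (F.P P.K).L θ.ν.r (gOfRecord₁₃ F N θ.toStage13Params P j)) j)
    (hε : ∀ P : B12.RunParams, Step.InInterval γ P.K (gOfRecord₁₃ F N θ.toStage13Params P) → ∀ j, 1 ≤ j → j ≤ P.K →
      0 < epsOfRecord θ.ν (gOfRecord₁₃ F N θ.toStage13Params P) j)
    (hε3 : ∀ P : B12.RunParams, Step.InInterval γ P.K (gOfRecord₁₃ F N θ.toStage13Params P) → ∀ j, 1 ≤ j → j ≤ P.K →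
      (143 * (((((F.P P.K).d + 4 : ℕ) : ℝ)) ^ 2 / 4) ^ 2) * epsOfRecord θ.ν (gOfRecord₁₃ F N θ.toStage13Params P) j ≤ 1 / 3)
    (hε2 : ∀ P : B12.RunParams, Step.InInterval γ P.K (gOfRecord₁₃ F N θ.toStage13Params P) → ∀ j, 1 ≤ j → j ≤ P.K →
      2 * epsOfRecord θ.ν (gOfRecord₁₃ F N θ.toStage13Params P) j ≤ 2 * ExpMeanLog.deltaSU (Fin N) / ((((F.P P.K).d + 4) * (F.P P.K).L : ℕ) : ℝ) ^ 2)
    (hsolv : ∀ P : B12.RunParams, Step.InInterval γ P.K (gOfRecord₁₃ F N θ.toStage13Params P) → ∀ j, 1 ≤ j → j ≤ P.K →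
      ∀ (s : SeqOfRecord F θ.ν θ.τ9.M (gOfRecord₁₃ F N θ.toStage13Params P) P.K j) (V : GaugeField (F.P P.K) j (SU N)),
      chiSeqOfRecord F N θ.ν θ.τ9.M (gOfRecord₁₃ F N θ.toStage13Params P) P.K j s V ≠ 0 →
      ∀ a ∈ cubesIn (fun a : ↥(cubeIndices (F.P P.K) (cubeSide (F.P P.K).L θ.ν.M₂ (RkOfRecord (F.P P.K).L θ.ν.r (gOfRecord₁₃ F N θ.toStage13Params P j)) j)) =>
          cubeEnl (F.P P.K) (cubeSide (F.P P.K).L θ.ν.M₂ (RkOfRecord (F.P P.K).L θ.ν.r (gOfRecord₁₃ F N θ.toStage13Params P j)) j) a 0) (s.Ω j),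
        ∃ U₀, IsMinimizer (avOfRecord F N P.K) {U | PlaqSmall (θ.ν.εreg * (F.P P.K).eta j ^ 2) U}
          (Bj θ.ν.M₁ (cubeEnl (F.P P.K) (cubeSide (F.P P.K).L θ.ν.M₂ (RkOfRecord (F.P P.K).L θ.ν.r (gOfRecord₁₃ F N θ.toStage13Params P j)) j) a 4) j)
          (avgFamily (avOfRecord F N P.K) (qsstarGIter0 j V)) U₀)
    (σ : (P : B12.RunParams) → Sect3Supplier θ P) (hσ : ∀ P : B12.RunParams, Step.InInterval γ P.K (gOfRecord₁₃ F N θ.toStage13Params P) → SupplierObligations θ P (σ P))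
    (hσB : ∀ P : B12.RunParams, Step.InInterval γ P.K (gOfRecord₁₃ F N θ.toStage13Params P) → SupplierBorel θ P (σ P)) :
    B16.Thm1Printed (datumOfRecord₁₃SepCoPH F N θ h).C :=
  thm1Printed_datumOfRecord₁₃CoPH_of_gaussCert_of_supplierBorel_of_bgFacts_of_powM θ hζ hq h.toCore hsel hθ hκ hE₀ hB₀ hM₁ hle hcR hγ
    (fun P hW => bgProvisoΛ_family_atRecord_of_provisos₁₃SepCoPH_of_flowIneq26 θ P h hr hβ hβγ hγθ hW (h26 P hW) (hCD P hW))
    hdiv hMa h3 hR hε hε3 hε2 hsolv σ hσ hσB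

/-- **★★★ … AT THE NAMED GAUSSIAN CERTIFICATE `gaussPinH θ`** (no class hypothesis; `gaussPinH_ζ0 ∕ gaussPinH_quad` `rfl`, key by `provisos₁₃SepCoPH_gaussPinH`; rows over `θ`'s Stage-13
letters serve the certificate verbatim). [cite: Balaban1988Convergent, Thm 1 p.262, Theorem p.245, §3 p.279, (2.6) p.255, (2.28) p.259, (3.16) p.268; Balaban1989LargeFieldII, Thm 1 p.355;
Balaban1989LargeFieldI, (0.3)–(0.4) p.176] -/
theorem thm1Printed_datumOfRecord₁₃SepCoPH_gaussPinH_of_supplierBorel_of_tailSuppliers_of_powM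
    (h : θ.Provisos₁₃SepCoPH F N) (hsel : θ.ppSel = ppSelLiveOfRecord F N θ.ν θ.τ9 (EOfRecord₁₃ F N θ.toStage13Params) (wOfRecord₉ F N θ.toStage9Params))
    (hθ : θ.Admissible F N) (hκ : 0 ≤ θ.s2.lf.κ) (hE₀ : 0 ≤ θ.s2.lf.E₀) (hB₀ : 0 ≤ θ.s2.lf.B₀)
    (hM₁ : 0 < θ.ν.M₁) (hle : θ.ν.M₁ ≤ θ.τ9.M) (hcR : 2 ≤ θ.s2.cR) {γ : ℝ} (hγ : 0 < γ)
    (hr : θ.ν.r = 1) {βup β₀ : ℝ} (hβ : 0 ≤ βup) (hβγ : βup * γ ^ 2 ≤ 1) (hγθ : γ ≤ θ.γ)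
    (h26 : ∀ P : B12.RunParams, Step.InInterval γ P.K (gOfRecord₁₃ F N θ.toStage13Params P) →
      B14.FlowIneq26 (gOfRecord₁₃ F N θ.toStage13Params P) βup β₀ P.K)
    (hCD : ∀ P : B12.RunParams, Step.InInterval γ P.K (gOfRecord₁₃ F N θ.toStage13Params P) →
      ∀ n₀, n₀ ≤ P.K → PartCompat₁₃ F N θ.toStage13Params P n₀ →
      (∀ j, n₀ < j → j ≤ P.K →
        (F.P P.K).sitesPerDir 0 < dCubeSide (F.P P.K).L θ.toStage13Params.τ9.M (RkOfRecord (F.P P.K).L θ.toStage13Params.ν.r (gOfRecord₁₃ F N θ.toStage13Params P j)) j) →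
      -- (C) global regularity of the all-small histories of the one-block tail
      (∀ m, n₀ < m → m ≤ P.K → ∀ (s : SeqOfRecord F θ.toStage13Params.ν θ.toStage13Params.τ9.M (gOfRecord₁₃ F N θ.toStage13Params P) P.K m) (W : MSField (F.P P.K) (SU N)),
        W ∈ suppOfRecord₁₃SepCoP F N θ.toStage13Params P m s →
        ∀ j, 1 ≤ j → j ≤ m → (∀ i, 1 ≤ i → i ≤ j → s.Ω i = Set.univ ∧ s.Λ i = Set.univ) → ∀ X : (Sect2.domSys (F.P P.K) θ.toStage13Params.τ9.M j).Dom,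
          Sect2.ofBackgroundC (settingOfRecord₁₃ F N θ.toStage13Params P).ι (UbgOfRecord₁₃CoP F N θ.toStage13Params P m s W) ∈
            Sect2.spaceI (settingOfRecord₁₃ F N θ.toStage13Params P) (θ.Rz P.K) θ.toStage13Params.τ9.M j (Sect2.domSites (F.P P.K) θ.toStage13Params.τ9.M j X)
              ((settingOfRecord₁₃ F N θ.toStage13Params P).lf.alpha0 ((settingOfRecord₁₃ F N θ.toStage13Params P).flow.g j))
              ((settingOfRecord₁₃ F N θ.toStage13Params P).lf.alpha1 ((settingOfRecord₁₃ F N θ.toStage13Params P).flow.g j))) ∧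
      -- (D) the large-field space at the switch levels of the one-block tail
      (∀ m, n₀ < m → m ≤ P.K → ∀ (s : SeqOfRecord F θ.toStage13Params.ν θ.toStage13Params.τ9.M (gOfRecord₁₃ F N θ.toStage13Params P) P.K m) (W : MSField (F.P P.K) (SU N)),
        W ∈ suppOfRecord₁₃SepCoP F N θ.toStage13Params P m s →
        ∀ j, n₀ < j → j ≤ m → (∀ i, 1 ≤ i → i < j → s.Ω i = Set.univ ∧ s.Λ i = Set.univ) → s.Ω j = Set.univ → s.Λ j = ∅ →
          (∀ i, j < i → i ≤ m → s.Ω i = ∅ ∧ s.Λ i = ∅) → ∀ X : (Sect2.domSys (F.P P.K) θ.toStage13Params.τ9.M j).Dom,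
            Sect2.ofBackgroundC (settingOfRecord₁₃ F N θ.toStage13Params P).ι (UbgOfRecord₁₃CoP F N θ.toStage13Params P m s W) ∈
              Sect2.spaceMS (settingOfRecord₁₃ F N θ.toStage13Params P) (θ.Rz P.K) θ.toStage13Params.τ9.M j (Sect2.domSites (F.P P.K) θ.toStage13Params.τ9.M j X) s.Ω))
    (hdiv : F.L * θ.ν.M₂ ∣ θ.τ9.M) {a : ℕ} (hMa : θ.τ9.M = F.L ^ a)
    (h3 : ∀ P : B12.RunParams, Step.InInterval γ P.K (gOfRecord₁₃ F N θ.toStage13Params P) → ∀ j, 1 ≤ j → j ≤ P.K →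
      3 * side (F.P P.K).L θ.toStage13Params.ν.M₁ j ≤ cubeSide (F.P P.K).L θ.toStage13Params.ν.M₂ (RkOfRecord (F.P P.K).L θ.toStage13Params.ν.r (gOfRecord₁₃ F N θ.toStage13Params P j)) j)
    (hR : ∀ P : B12.RunParams, Step.InInterval γ P.K (gOfRecord₁₃ F N θ.toStage13Params P) → ∀ j, 1 ≤ j → j ≤ P.K →
      (F.P P.K).L ^ j + (((F.P P.K).d + 4) * (F.P P.K).L + 2) * (∑ l ∈ Finset.range j, (F.P P.K).L ^ l) + 2 ≤
        cubeSide (F.P P.K).L θ.toStage13Params.ν.M₂ (RkOfRecord (F.P P.K).L θ.toStage13Params.ν.r (gOfRecord₁₃ F N θ.toStage13Params P j)) j)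
    (hε : ∀ P : B12.RunParams, Step.InInterval γ P.K (gOfRecord₁₃ F N θ.toStage13Params P) → ∀ j, 1 ≤ j → j ≤ P.K →
      0 < epsOfRecord θ.toStage13Params.ν (gOfRecord₁₃ F N θ.toStage13Params P) j)
    (hε3 : ∀ P : B12.RunParams, Step.InInterval γ P.K (gOfRecord₁₃ F N θ.toStage13Params P) → ∀ j, 1 ≤ j → j ≤ P.K →
      (143 * (((((F.P P.K).d + 4 : ℕ) : ℝ)) ^ 2 / 4) ^ 2) * epsOfRecord θ.toStage13Params.ν (gOfRecord₁₃ F N θ.toStage13Params P) j ≤ 1 / 3)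
    (hε2 : ∀ P : B12.RunParams, Step.InInterval γ P.K (gOfRecord₁₃ F N θ.toStage13Params P) → ∀ j, 1 ≤ j → j ≤ P.K →
      2 * epsOfRecord θ.toStage13Params.ν (gOfRecord₁₃ F N θ.toStage13Params P) j ≤ 2 * ExpMeanLog.deltaSU (Fin N) / ((((F.P P.K).d + 4) * (F.P P.K).L : ℕ) : ℝ) ^ 2)
    (hsolv : ∀ P : B12.RunParams, Step.InInterval γ P.K (gOfRecord₁₃ F N θ.toStage13Params P) → ∀ j, 1 ≤ j → j ≤ P.K →
      ∀ (s : SeqOfRecord F θ.toStage13Params.ν θ.toStage13Params.τ9.M (gOfRecord₁₃ F N θ.toStage13Params P) P.K j) (V : GaugeField (F.P P.K) j (SU N)),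
      chiSeqOfRecord F N θ.toStage13Params.ν θ.toStage13Params.τ9.M (gOfRecord₁₃ F N θ.toStage13Params P) P.K j s V ≠ 0 →
      ∀ a ∈ cubesIn (fun a : ↥(cubeIndices (F.P P.K) (cubeSide (F.P P.K).L θ.toStage13Params.ν.M₂ (RkOfRecord (F.P P.K).L θ.toStage13Params.ν.r (gOfRecord₁₃ F N θ.toStage13Params P j)) j)) =>
          cubeEnl (F.P P.K) (cubeSide (F.P P.K).L θ.toStage13Params.ν.M₂ (RkOfRecord (F.P P.K).L θ.toStage13Params.ν.r (gOfRecord₁₃ F N θ.toStage13Params P j)) j) a 0) (s.Ω j),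
        ∃ U₀, IsMinimizer (avOfRecord F N P.K) {U | PlaqSmall (θ.toStage13Params.ν.εreg * (F.P P.K).eta j ^ 2) U}
          (Bj θ.toStage13Params.ν.M₁ (cubeEnl (F.P P.K) (cubeSide (F.P P.K).L θ.toStage13Params.ν.M₂ (RkOfRecord (F.P P.K).L θ.toStage13Params.ν.r (gOfRecord₁₃ F N θ.toStage13Params P j)) j) a 4) j)
          (avgFamily (avOfRecord F N P.K) (qsstarGIter0 j V)) U₀)
    (σ : (P : B12.RunParams) → Sect3Supplier (gaussPinH θ) P)
    (hσ : ∀ P : B12.RunParams, Step.InInterval γ P.K (gOfRecord₁₃ F N θ.toStage13Params P) → SupplierObligations (gaussPinH θ) P (σ P))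
    (hσB : ∀ P : B12.RunParams, Step.InInterval γ P.K (gOfRecord₁₃ F N θ.toStage13Params P) → SupplierBorel (gaussPinH θ) P (σ P)) :
    B16.Thm1Printed (datumOfRecord₁₃SepCoPH F N (gaussPinH θ) (provisos₁₃SepCoPH_gaussPinH h)).C :=
  thm1Printed_datumOfRecord₁₃SepCoPH_of_gaussCert_of_supplierBorel_of_tailSuppliers_of_powM (gaussPinH θ) (gaussPinH_ζ0 θ) (gaussPinH_quad θ)
    (provisos₁₃SepCoPH_gaussPinH h) hsel hθ hκ hE₀ hB₀ hM₁ hle hcR hγ hr hβ hβγ hγθ h26 hCD hdiv hMa h3 hR hε hε3 hε2 hsolv σ hσ hσB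

end Printed

end Summit.QuantumFields.YangMills.Theorems.BalabanUVNodesN11NodeFaceOfTailSuppliers

end
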